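import Summits.CriticalPhenomena.PercolationContinuityZ3.Theorems.Transplant.SkelPhiParaFrameChange
import Summits.CriticalPhenomena.PercolationContinuityZ3.Theorems.Transplant.TwoAxisParaCellsFine
import HarnessLib

/-!
# N1 (the `{±1}` node), LEVEL 1, (C) column file (C-N4′): the FRAME CHANGE of the two-frame (C) corridor at hp-8's FINE cell map
# `fineSkel φ t₀ A n h vα vβ c₀ c₁ s₀ s₁ D` (one multiplier per axis, design owner's ruling 13:19:49Z (R3)) — the two-coordinate statements of
# `SkelPhiParaFrameChange` (which read both coordinates at ONE multiplier `c`) restated with `c₀ ≠ c₁`: `c₀c₁·A·m·|Δα| ≤ D·(c₁n(K₀+1) + c₀|vα|(K₁+1))`,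
# `c₁·A·|Δβ′| ≤ D·(K₁+1)`, the run box, and the cross link `WinIn (fineSkel …) Ω (fine box) ⊆ WinIn (runX …) Ω (run box)` of `WinChainData.chain₂`.
# The one-coordinate lemmas of (C-N3)/(C-N4) apply at `fineSkel` verbatim with `c := c₀` (coordinate 0) / `c := c₁` (coordinate 1) since
# `fineSkel … w i = coarse cᵢ sᵢ D (lamᵢ …)` by `rfl`.

builds on p205010 (kernel theorem, internal audit signed; external expert review pending) — nothing in this file uses p205010; nothing here is a
claim about the open node `SamePDropOfSkeletonNeg`.
Lane `prim-bschramm`, seat `prim-bschramm-p5` (gen 8; (C) lineage); helper file (`--supports stmt-CriticalPhenomena-4575`).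
* **`run_bounds_of_fine_bounds`**, **`relCoord_shearCoord_le_of_fine`**, **`runX_mem_Icc_of_fine`**, **`winIn_fine_subset_winIn_runX`**.
[cite: MartineauTassion2017, §4.1 (the lattice z₁u + z₂v)] [cite: KozmaNitzan2024, §4 Lemma 12 (pp. 23–25)]
-/

noncomputable section

namespace Summit.CriticalPhenomena.PercolationContinuityZ3.Theorems.Transplant

namespace Skelφ

open Literature.Probability.Percolation Literature.Probability.LatticeModels SimpleGraph
open TwoAxis.Para (coarse lam0 lam1 modulus)

variable {V : Type} {G : SimpleGraph V} {φ : V → Site 2}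

/-- **Scaled run bounds from fine bounds**: `|Δρ₀| ≤ K₀`, `|Δρ₁| ≤ K₁` in the fine skeleton (multipliers `c₀`, `c₁`) give
`c₀·c₁·A·m·|Δα| ≤ D·(c₁·n(K₀+1) + c₀·|vα|(K₁+1))` and `c₁·A·|Δβ′| ≤ D·(K₁+1)`. [cite: MartineauTassion2017, §4.1] -/
theorem run_bounds_of_fine_bounds {A : ℤ} (hA : 0 ≤ A) {n : ℕ} {h vα vβ : ℤ} (hm : 0 ≤ modulus n h vα vβ) {c₀ c₁ s₀ s₁ D : ℤ} (hc₀ : 0 ≤ c₀)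
    (hc₁ : 0 ≤ c₁) (hD : 0 < D) (t₀ c g : V) {K₀ K₁ : ℤ}
    (h0 : |fineSkel φ t₀ A n h vα vβ c₀ c₁ s₀ s₁ D g 0 - fineSkel φ t₀ A n h vα vβ c₀ c₁ s₀ s₁ D c 0| ≤ K₀)
    (h1 : |fineSkel φ t₀ A n h vα vβ c₀ c₁ s₀ s₁ D g 1 - fineSkel φ t₀ A n h vα vβ c₀ c₁ s₀ s₁ D c 1| ≤ K₁) :
    c₀ * c₁ * A * modulus n h vα vβ * |relCoord φ c 0 g| ≤ D * (c₁ * (n : ℤ) * (K₀ + 1) + c₀ * |vα| * (K₁ + 1)) ∧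
      c₁ * A * |shearCoord φ c n h g| ≤ D * (K₁ + 1) := by
  simp only [fineSkel_apply_zero, fineSkel_apply_one] at h0 h1
  have e0 := abs_mul_sub_le_of_coarse hD h0
  have e1 := abs_mul_sub_le_of_coarse hD h1
  rw [← mul_sub] at e0 e1
  constructor
  · have e := A_mul_modulus_mul_relCoord_eq (φ := φ) A n h vα vβ t₀ c g
    set X₀ := c₀ * (lam0 A vα vβ (relφ φ t₀ g) - lam0 A vα vβ (relφ φ t₀ c)) with hX₀
    set X₁ := c₁ * (lam1 A n h (relφ φ t₀ g) - lam1 A n h (relφ φ t₀ c)) with hX₁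
    have key : c₀ * c₁ * A * modulus n h vα vβ * relCoord φ c 0 g = c₁ * (n : ℤ) * X₀ + c₀ * vα * X₁ := by
      rw [hX₀, hX₁]; linear_combination c₀ * c₁ * e
    have hpos : 0 ≤ c₀ * c₁ * A * modulus n h vα vβ := by positivity
    calc c₀ * c₁ * A * modulus n h vα vβ * |relCoord φ c 0 g|
        = |c₀ * c₁ * A * modulus n h vα vβ| * |relCoord φ c 0 g| := by rw [abs_of_nonneg hpos]
      _ = |c₀ * c₁ * A * modulus n h vα vβ * relCoord φ c 0 g| := (abs_mul _ _).symm
      _ = |c₁ * (n : ℤ) * X₀ + c₀ * vα * X₁| := by rw [key]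
      _ ≤ |c₁ * (n : ℤ) * X₀| + |c₀ * vα * X₁| := abs_add_le _ _
      _ = c₁ * (n : ℤ) * |X₀| + c₀ * |vα| * |X₁| := by
          rw [abs_mul (c₁ * (n : ℤ)) X₀, abs_mul (c₀ * vα) X₁, abs_mul c₁ (n : ℤ), abs_mul c₀ vα, Nat.abs_cast, abs_of_nonneg hc₁, abs_of_nonneg hc₀]
      _ ≤ c₁ * (n : ℤ) * (D * (K₀ + 1) - 1) + c₀ * |vα| * (D * (K₁ + 1) - 1) :=
        add_le_add (mul_le_mul_of_nonneg_left e0 (by positivity)) (mul_le_mul_of_nonneg_left e1 (by positivity))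
      _ ≤ D * (c₁ * (n : ℤ) * (K₀ + 1) + c₀ * |vα| * (K₁ + 1)) := by
          have h1' : 0 ≤ c₁ * (n : ℤ) := by positivity
          have h2' : 0 ≤ c₀ * |vα| := by positivity
          nlinarith
  · rw [lam1_sub_origin] at e1
    calc c₁ * A * |shearCoord φ c n h g| = |c₁ * (A * shearCoord φ c n h g)| := by
          rw [abs_mul, abs_mul, abs_of_nonneg hc₁, abs_of_nonneg hA]; ring
      _ ≤ D * (K₁ + 1) - 1 := e1
      _ ≤ D * (K₁ + 1) := by linarith

/-- **Run coordinates from fine coordinates**: under `D(c₁n(K₀+1) + c₀|vα|(K₁+1)) ≤ c₀c₁·A·m·a` and `D(K₁+1) ≤ c₁·A·B` the fine bounds give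
`|Δα| ≤ a` and `|Δβ′| ≤ B`. [cite: MartineauTassion2017, §4.1] -/
theorem relCoord_shearCoord_le_of_fine {A : ℤ} (hA : 0 < A) {n : ℕ} {h vα vβ : ℤ} (hm : 0 < modulus n h vα vβ) {c₀ c₁ s₀ s₁ D : ℤ}
    (hc₀ : 0 < c₀) (hc₁ : 0 < c₁) (hD : 0 < D) (t₀ c g : V) {K₀ K₁ a B : ℤ}
    (h0 : |fineSkel φ t₀ A n h vα vβ c₀ c₁ s₀ s₁ D g 0 - fineSkel φ t₀ A n h vα vβ c₀ c₁ s₀ s₁ D c 0| ≤ K₀)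
    (h1 : |fineSkel φ t₀ A n h vα vβ c₀ c₁ s₀ s₁ D g 1 - fineSkel φ t₀ A n h vα vβ c₀ c₁ s₀ s₁ D c 1| ≤ K₁)
    (ha : D * (c₁ * (n : ℤ) * (K₀ + 1) + c₀ * |vα| * (K₁ + 1)) ≤ c₀ * c₁ * A * modulus n h vα vβ * a) (hB : D * (K₁ + 1) ≤ c₁ * A * B) :
    |relCoord φ c 0 g| ≤ a ∧ |shearCoord φ c n h g| ≤ B := by
  obtain ⟨e0, e1⟩ := run_bounds_of_fine_bounds hA.le hm.le hc₀.le hc₁.le hD t₀ c g h0 h1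
  have hp0 : 0 < c₀ * c₁ * A * modulus n h vα vβ := by positivity
  have hp1 : 0 < c₁ * A := by positivity
  exact ⟨le_of_mul_le_mul_left (e0.trans ha) hp0, le_of_mul_le_mul_left (e1.trans hB) hp1⟩

/-- **The run-frame box of a fine box**: as `runX_mem_Icc_of_coarse`, at the fine skeleton. [cite: MartineauTassion2017, §4.1] -/
theorem runX_mem_Icc_of_fine {A : ℤ} (hA : 0 < A) {n : ℕ} (hn : 1 ≤ n) {h vα vβ : ℤ} (hm : 0 < modulus n h vα vβ) {c₀ c₁ s₀ s₁ D : ℤ}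
    (hc₀ : 0 < c₀) (hc₁ : 0 < c₁) (hD : 0 < D) (t₀ c g : V) {σ : ℤ} (hσ : σ = 1 ∨ σ = -1) {K₀ K₁ a B b : ℤ}
    (h0 : |fineSkel φ t₀ A n h vα vβ c₀ c₁ s₀ s₁ D g 0 - fineSkel φ t₀ A n h vα vβ c₀ c₁ s₀ s₁ D c 0| ≤ K₀)
    (h1 : |fineSkel φ t₀ A n h vα vβ c₀ c₁ s₀ s₁ D g 1 - fineSkel φ t₀ A n h vα vβ c₀ c₁ s₀ s₁ D c 1| ≤ K₁)
    (ha : D * (c₁ * (n : ℤ) * (K₀ + 1) + c₀ * |vα| * (K₁ + 1)) ≤ c₀ * c₁ * A * modulus n h vα vβ * a) (hB : D * (K₁ + 1) ≤ c₁ * A * B)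
    (hb : B / (shearUnit n h : ℤ) + 1 ≤ b) :
    runX φ c n h σ g ∈ Finset.Icc (-(![a, b] : Site 2)) ![a, b] := by
  obtain ⟨hα, hβ⟩ := relCoord_shearCoord_le_of_fine hA hm hc₀ hc₁ hD t₀ c g h0 h1 ha hB
  have hsu : (0 : ℤ) < shearUnit n h := shearUnit_pos hn h
  have hσabs : |σ| = 1 := by rcases hσ with rfl | rfl <;> norm_num
  have hσα : |σ * relCoord φ c 0 g| ≤ a := by rw [abs_mul, hσabs, one_mul]; exact hα
  have hσβ : |σ * shearCoord φ c n h g| ≤ B := by rw [abs_mul, hσabs, one_mul]; exact hβ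
  have hdiv : |σ * shearCoord φ c n h g / (shearUnit n h : ℤ)| ≤ b := (abs_ediv_le_of_abs_le hsu hσβ).trans hb
  rw [abs_le] at hσα hdiv
  rw [Finset.mem_Icc, Pi.le_def, Pi.le_def, Fin.forall_fin_two, Fin.forall_fin_two]
  simp only [Pi.neg_apply, runX_zero, runX_one, Matrix.cons_val_zero, Matrix.cons_val_one]
  exact ⟨⟨hσα.1, hdiv.1⟩, hσα.2, hdiv.2⟩

/-- **THE FRAME CHANGE AT THE FINE CELL MAP** (cross link `hx` of `WinChainData.chain₂` for the N1 scheme of record): inside a habitat `Ω`, the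
window over the fine box `ρ(c) ± (K₀, K₁)` lies in the window over the run box `±(a, b)` of `runX φ c n h σ`. [cite: KozmaNitzan2024, §4 Lemma 12 (pp. 23–25)] -/
theorem winIn_fine_subset_winIn_runX [DecidableEq V] {A : ℤ} (hA : 0 < A) {n : ℕ} (hn : 1 ≤ n) {h vα vβ : ℤ} (hm : 0 < modulus n h vα vβ)
    {c₀ c₁ s₀ s₁ D : ℤ} (hc₀ : 0 < c₀) (hc₁ : 0 < c₁) (hD : 0 < D) (t₀ c : V) {σ : ℤ} (hσ : σ = 1 ∨ σ = -1) (Ω : Finset V) {K₀ K₁ : ℕ} {a B b : ℤ}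
    (ha : D * (c₁ * (n : ℤ) * (K₀ + 1) + c₀ * |vα| * (K₁ + 1)) ≤ c₀ * c₁ * A * modulus n h vα vβ * a) (hB : D * ((K₁ : ℤ) + 1) ≤ c₁ * A * B)
    (hb : B / (shearUnit n h : ℤ) + 1 ≤ b) :
    WinIn (fineSkel φ t₀ A n h vα vβ c₀ c₁ s₀ s₁ D) Ω
        (Finset.Icc (fineSkel φ t₀ A n h vα vβ c₀ c₁ s₀ s₁ D c - ![(K₀ : ℤ), K₁]) (fineSkel φ t₀ A n h vα vβ c₀ c₁ s₀ s₁ D c + ![(K₀ : ℤ), K₁])) ⊆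
      WinIn (runX φ c n h σ) Ω (Finset.Icc (-(![a, b] : Site 2)) ![a, b]) := by
  intro g hg
  rw [mem_WinIn] at hg ⊢
  obtain ⟨hgΩ, hgρ⟩ := hg
  rw [Finset.mem_Icc, Pi.le_def, Pi.le_def, Fin.forall_fin_two, Fin.forall_fin_two] at hgρ
  simp only [Pi.sub_apply, Pi.add_apply, Matrix.cons_val_zero, Matrix.cons_val_one] at hgρ
  obtain ⟨⟨h0l, h1l⟩, h0u, h1u⟩ := hgρ
  refine ⟨hgΩ, runX_mem_Icc_of_fine (s₀ := s₀) (s₁ := s₁) hA hn hm hc₀ hc₁ hD t₀ c g hσ (abs_le.2 ⟨by linarith, by linarith⟩)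
    (abs_le.2 ⟨by linarith, by linarith⟩) ha hB hb⟩

end Skelφ

end Summit.CriticalPhenomena.PercolationContinuityZ3.Theorems.Transplant

end
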